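import Literature.NumberTheory.Sieve.HeathBrownMorozClassLineCount
import Literature.NumberTheory.Sieve.HeathBrownMorozClassFamily
import HarnessLib

/-!
# Heath-Brown–Moroz 2004, §2: the class lattice count `S_{d,γ}(R; X)` and its error for one `R` ([3, (5.2)])

Second brick of the class Type-I estimate (HBM04 Lemmas 2.2–2.3 = [HeathBrownActa2001, Lemmas 5.1/3.2] for
the class family `CubicSieve.classPairs` of `HeathBrownMorozClassFamily`).  We define the class analogue
`classLatticeCount X η d a b R` of Heath-Brown's `S(R; X)` (`latticeCount`: no coprimality of `x, y`) — the
pairs `x, y ∈ (X, X(1+η)]` with `x ≡ a`, `y ≡ b (mod d)` and `R ∣ x + y·2^{1/3}` — and prove, for `R ∈ 𝒯r`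
(square-free norm) with `(N(R), d) = 1` and a reduced class `a, b < d ≤ X`, the per-`R` error bound of
[3, (5.2)] with the SAME right-hand side as the tree's `abs_latticeCount_sub_le` (up to `9X/N(R)` for
`3X/N(R)`): in the quotient coordinates `x = a + dx'`, `y = b + dy'` the condition is the shifted line
`N(R) ∣ x' + ny' + s` in a rectangle (`HeathBrownMorozClassLineCount`), whose Fourier error is Heath-Brown's.
Contents: `classLatticeCount`, `classCountA_le_classLatticeCount`, `classLatticeCount_eq_zero_of_not_coprime`
(admissible class, `(N R, d) > 1`), `classLatticeCount_eq_card_rect` (the reparametrisation),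
**`abs_classLatticeCount_sub_le`**.

## References

* D. R. Heath-Brown, B. Z. Moroz, Proc. LMS (3) 88 (2004), §2, Lemma 2.2, (2.10). [cite: HeathBrownMoroz2004, Lemma 2.2]
* D. R. Heath-Brown, Acta Math. 186 (2001), §5, Lemma 5.1 and (5.2). [cite: HeathBrownActa2001, §5 (5.2)]

## Mathlib / tree search

Tree: `latticeBox`, `latticeBox_eq_product`, `mem_latticeBox_iff`, `boxPairs_eq_filter_latticeBox`,
`dvd_pairIdeal_iff_absNorm_dvd`, `dvd_span_sub_mul_θint_iff`, `exists_int_θint_sub_mem_of_squarefree`,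
`norm_sum_Ioc_e_le_length`, `norm_sum_Ioc_e_le_div_min`, `sum_e_mul_eq_sum_e_emod`, the centring lemmas
(`HeathBrownCubicLemma51`); `card_filter_dvd_shift_eq_sum`, `abs_card_filter_dvd_shift_sub_le`,
`dvd_affine_iff_dvd_shift` (`HeathBrownMorozClassLineCount`); `classPairs`, `classAPairs`, `classCountA`
(`HeathBrownMorozClassFamily`); Mathlib `Nat.isCoprime_iff_coprime`, `Nat.div_lt_iff_lt_mul`, `Nat.le_div_iff_mul_le`.
-/

noncomputable section

open Finset NumberField

namespace Literature.NumberTheory.Sieve.CubicSieve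

open LFunctions.CubeRootTwoField CubicPrimes Literature.NumberTheory.Sieve.LargeSieve

open scoped Classical in
/-- **`S_{d,γ}(R; X)`**: the pairs `x, y ∈ (X, X(1+η)]` (no coprimality) with `x ≡ a`, `y ≡ b (mod d)` and
`R ∣ (x + y·2^{1/3})` — the class analogue of Heath-Brown's `S(R; X)` (`latticeCount`), i.e. the count
`#𝒜_𝔞` of HBM04 (2.4)/(2.10) before the coprimality sieve. [cite: HeathBrownMoroz2004, §2 (2.10)] -/
def classLatticeCount (X η : ℝ) (d a b : ℕ) (R : Ideal (𝓞 K)) : ℕ :=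
  #{xy ∈ latticeBox X η | xy.1 ≡ a [MOD d] ∧ xy.2 ≡ b [MOD d] ∧ R ∣ pairIdeal xy}

open scoped Classical in
/-- `#𝒜_R(class) ≤ S_{d,γ}(R; X)` (drop the coprimality of `x, y`). [cite: HeathBrownMoroz2004, §2 (2.4)] -/
theorem classCountA_le_classLatticeCount (X η : ℝ) (d a b : ℕ) (R : Ideal (𝓞 K)) :
    classCountA X η d a b R ≤ classLatticeCount X η d a b R := by
  rw [classCountA, classLatticeCount]
  refine card_le_card fun xy hxy => ?_
  rw [mem_classAPairs_iff, mem_classPairs_iff, boxPairs_eq_filter_latticeBox, mem_filter] at hxy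
  rw [mem_filter]
  exact ⟨hxy.1.1.1, hxy.1.2.1, hxy.1.2.2, hxy.2⟩

open scoped Classical in
/-- **`S_{d,γ}(R; X) = 0` unless `(N R, d) = 1`** (admissible class): `R ∣ (x + y·2^{1/3})` forces
`N R ∣ x³ + 2y³ ≡ a³ + 2b³ (mod d)`. [cite: HeathBrownMoroz2004, Lemma 2.4] -/
theorem classLatticeCount_eq_zero_of_not_coprime {X η : ℝ} {d a b : ℕ}
    (hadm : Nat.Coprime (a ^ 3 + 2 * b ^ 3) d) {R : Ideal (𝓞 K)} (hR : ¬ Nat.Coprime (Ideal.absNorm R) d) :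
    classLatticeCount X η d a b R = 0 := by
  rw [classLatticeCount, card_eq_zero]
  refine eq_empty_of_forall_notMem fun xy hxy => hR ?_
  rw [mem_filter] at hxy
  obtain ⟨-, ha, hb, hdvd⟩ := hxy
  have h1 : Ideal.absNorm R ∣ xy.1 ^ 3 + 2 * xy.2 ^ 3 := by
    rw [← absNorm_pairIdeal]
    exact Ideal.absNorm_dvd_absNorm_of_le (Ideal.le_of_dvd hdvd)
  have h : xy.1 ^ 3 + 2 * xy.2 ^ 3 ≡ a ^ 3 + 2 * b ^ 3 [MOD d] := (ha.pow 3).add ((hb.pow 3).mul_left 2)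
  have hc : Nat.Coprime (xy.1 ^ 3 + 2 * xy.2 ^ 3) d := by rw [Nat.Coprime, h.gcd_eq]; exact hadm
  exact Nat.Coprime.coprime_dvd_left h1 hc

/-- The class residues inside an integer interval: for `a ≤ A`, the `x ∈ (A, M]` with
`x ≡ a (mod d)` are exactly the `a + dx'` with `x' ∈ ((A − a)/d, (M − a)/d]` (natural-number division).
[cite: HeathBrownMoroz2004, §2 (2.10)] -/
theorem mem_Ioc_modEq_iff {d a A M : ℕ} (hd : 0 < d) (haA : a ≤ A) (x : ℕ) :
    (x ∈ Ioc A M ∧ x ≡ a [MOD d]) ↔ ∃ x' ∈ Ioc ((A - a) / d) ((M - a) / d), x = a + d * x' := by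
  constructor
  · rintro ⟨hx, hmod⟩
    rw [mem_Ioc] at hx
    have hax : a ≤ x := haA.trans hx.1.le
    obtain ⟨x', hx'⟩ : d ∣ x - a := (Nat.modEq_iff_dvd' hax).1 hmod.symm
    refine ⟨x', ?_, by omega⟩
    rw [mem_Ioc, Nat.div_lt_iff_lt_mul hd, Nat.le_div_iff_mul_le hd, mul_comm x' d]
    constructor <;> omega
  · rintro ⟨x', hx', rfl⟩
    rw [mem_Ioc, Nat.div_lt_iff_lt_mul hd, Nat.le_div_iff_mul_le hd, mul_comm x' d] at hx'
    refine ⟨mem_Ioc.2 ⟨by omega, by omega⟩, ?_⟩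
    exact (Nat.modEq_iff_dvd' (Nat.le_add_right a _)).2 (by simp) |>.symm

open scoped Classical in
/-- **The class lattice count as a shifted line count in a rectangle**: for `R ∈ 𝒯r` with `2^{1/3} ≡ n (mod R)`,
`a, b < d ≤ X` and `N(R) ∣ du − 1`:
`S_{d,γ}(R; X) = #{(x', y') ∈ B₁ × B₂ : N(R) ∣ x' + ny' + u(a + nb)}` with
`B₁ = ((⌊X⌋ − a)/d, (⌊X(1+η)⌋ − a)/d]`, `B₂` likewise with `b`. [cite: HeathBrownMoroz2004, §2 (2.10)] -/
theorem classLatticeCount_eq_card_rect {R : Ideal (𝓞 K)} (hR : Squarefree (Ideal.absNorm R)) {n : ℤ}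
    (hn : θint - (n : 𝓞 K) ∈ R) {d a b : ℕ} {u : ℤ} (hu : ((Ideal.absNorm R : ℕ) : ℤ) ∣ (d : ℤ) * u - 1)
    {X η : ℝ} (hd : 0 < d) (ha : a < d) (hb : b < d) (hX : (d : ℝ) ≤ X) :
    classLatticeCount X η d a b R =
      #{xy ∈ Ioc ((⌊X⌋₊ - a) / d) ((⌊X * (1 + η)⌋₊ - a) / d) ×ˢ Ioc ((⌊X⌋₊ - b) / d) ((⌊X * (1 + η)⌋₊ - b) / d) |
        ((Ideal.absNorm R : ℕ) : ℤ) ∣ (xy.1 : ℤ) + (xy.2 : ℤ) * n + u * (a + n * b)} := by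
  have hX0 : 0 ≤ X := le_trans (Nat.cast_nonneg d) hX
  have hdA : d ≤ ⌊X⌋₊ := Nat.le_floor hX
  have haA : a ≤ ⌊X⌋₊ := ha.le.trans hdA
  have hbA : b ≤ ⌊X⌋₊ := hb.le.trans hdA
  let φ : ℕ × ℕ ↪ ℕ × ℕ := ⟨fun q => (a + d * q.1, b + d * q.2), fun q q' h => by
    simp only [Prod.mk.injEq] at h
    exact Prod.ext (Nat.eq_of_mul_eq_mul_left hd (by omega)) (Nat.eq_of_mul_eq_mul_left hd (by omega))⟩
  rw [classLatticeCount, latticeBox_eq_product hX0]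
  symm
  rw [← card_map φ]
  congr 1
  refine Finset.ext fun p => ?_
  simp only [mem_filter, mem_product, Finset.mem_map, Prod.exists]
  constructor
  · rintro ⟨x', y', ⟨⟨hx', hy'⟩, hdvd⟩, hq⟩
    have hpx : p.1 = a + d * x' := by rw [← hq]; rfl
    have hpy : p.2 = b + d * y' := by rw [← hq]; rfl
    obtain ⟨hx, hma⟩ := (mem_Ioc_modEq_iff (M := ⌊X * (1 + η)⌋₊) hd haA p.1).2 ⟨x', hx', hpx⟩
    obtain ⟨hy, hmb⟩ := (mem_Ioc_modEq_iff (M := ⌊X * (1 + η)⌋₊) hd hbA p.2).2 ⟨y', hy', hpy⟩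
    refine ⟨⟨hx, hy⟩, hma, hmb, ?_⟩
    rw [dvd_pairIdeal_iff_absNorm_dvd hR hn, hpx, hpy]
    simp only [Nat.cast_add, Nat.cast_mul]
    exact (dvd_affine_iff_dvd_shift hu a b n x' y').2 hdvd
  · rintro ⟨⟨hx, hy⟩, hma, hmb, hdvd⟩
    obtain ⟨x', hx', hpx⟩ := (mem_Ioc_modEq_iff (M := ⌊X * (1 + η)⌋₊) hd haA p.1).1 ⟨hx, hma⟩
    obtain ⟨y', hy', hpy⟩ := (mem_Ioc_modEq_iff (M := ⌊X * (1 + η)⌋₊) hd hbA p.2).1 ⟨hy, hmb⟩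
    refine ⟨x', y', ⟨⟨hx', hy'⟩, ?_⟩, Prod.ext hpx.symm hpy.symm⟩
    rw [dvd_pairIdeal_iff_absNorm_dvd hR hn, hpx, hpy] at hdvd
    simp only [Nat.cast_add, Nat.cast_mul] at hdvd
    exact (dvd_affine_iff_dvd_shift hu a b n x' y').1 hdvd

/-- The side of the quotient box: for `a < d`, `d ≤ X`, `0 ≤ η ≤ 1`, `2 ≤ X`, the number
`L₁ = (⌊X(1+η)⌋ − a)/d − (⌊X⌋ − a)/d` of `x'` satisfies `|L₁ − ηX/d| ≤ 2` and `L₁ ≤ 2X`.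
[cite: HeathBrownMoroz2004, §2 (2.10)] -/
theorem quotient_side_bounds {X η : ℝ} {d a : ℕ} (hd : 0 < d) (ha : a < d) (hX : (d : ℝ) ≤ X) (hX2 : 2 ≤ X)
    (hη0 : 0 ≤ η) (hη1 : η ≤ 1) :
    (⌊X⌋₊ - a) / d ≤ (⌊X * (1 + η)⌋₊ - a) / d ∧
    |(((⌊X * (1 + η)⌋₊ - a) / d - (⌊X⌋₊ - a) / d : ℕ) : ℝ) - η * X / d| ≤ 2 ∧
    (((⌊X * (1 + η)⌋₊ - a) / d - (⌊X⌋₊ - a) / d : ℕ) : ℝ) ≤ 2 * X := by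
  have hX0 : 0 ≤ X := by linarith
  set A := ⌊X⌋₊ with hA
  set M := ⌊X * (1 + η)⌋₊ with hM
  have hdA : d ≤ A := Nat.le_floor hX
  have haA : a ≤ A := ha.le.trans hdA
  have hAM : A ≤ M := Nat.floor_le_floor (by nlinarith)
  have hmono : (A - a) / d ≤ (M - a) / d := Nat.div_le_div_right (by omega)
  refine ⟨hmono, ?_⟩
  have hd0 : (0 : ℝ) < d := by exact_mod_cast hd
  -- real bounds on the two quotients
  have hq1 : ((((M - a) / d : ℕ)) : ℝ) ≤ ((M : ℝ) - a) / d := by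
    have := Nat.cast_div_le (m := M - a) (n := d) (α := ℝ)
    rw [Nat.cast_sub (haA.trans hAM)] at this; exact this
  have hq1' : ((M : ℝ) - a) / d - 1 < (((M - a) / d : ℕ) : ℝ) := by
    have h := Nat.lt_div_mul_add (a := M - a) hd
    have h' : ((M - a : ℕ) : ℝ) < ((M - a) / d : ℕ) * d + d := by exact_mod_cast h
    rw [Nat.cast_sub (haA.trans hAM)] at h'
    rw [div_sub_one hd0.ne', div_lt_iff₀ hd0]; linarith
  have hq2 : ((((A - a) / d : ℕ)) : ℝ) ≤ ((A : ℝ) - a) / d := by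
    have := Nat.cast_div_le (m := A - a) (n := d) (α := ℝ)
    rw [Nat.cast_sub haA] at this; exact this
  have hq2' : ((A : ℝ) - a) / d - 1 < (((A - a) / d : ℕ) : ℝ) := by
    have h := Nat.lt_div_mul_add (a := A - a) hd
    have h' : ((A - a : ℕ) : ℝ) < ((A - a) / d : ℕ) * d + d := by exact_mod_cast h
    rw [Nat.cast_sub haA] at h'
    rw [div_sub_one hd0.ne', div_lt_iff₀ hd0]; linarith
  have hA1 : (A : ℝ) ≤ X := Nat.floor_le hX0
  have hA2 : X < A + 1 := Nat.lt_floor_add_one X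
  have hM1 : (M : ℝ) ≤ X * (1 + η) := Nat.floor_le (by positivity)
  have hM2 : X * (1 + η) < M + 1 := Nat.lt_floor_add_one _
  rw [Nat.cast_sub hmono]
  have hd1 : (1 : ℝ) ≤ d := by exact_mod_cast hd
  have e1 : ((M : ℝ) - a) / d - ((A : ℝ) - a) / d = ((M : ℝ) - A) / d := by field_simp; ring
  have hMA : |((M : ℝ) - A) / d - η * X / d| ≤ 1 := by
    rw [← sub_div, abs_div, abs_of_pos hd0, div_le_one hd0, abs_le]; constructor <;> nlinarith
  constructor
  · rw [abs_le] at hMA ⊢; constructor <;> linarith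
  · have : η * X / d ≤ X := by
      rw [div_le_iff₀ hd0]; nlinarith
    rw [abs_le] at hMA; linarith

set_option maxHeartbeats 1000000 in
open scoped Classical in
/-- **The error term of `S_{d,γ}(R; X)` for one `R ∈ 𝒯r` coprime to `d`, `Q < N(R) ≤ 2Q`** — the class
analogue of the tree's `abs_latticeCount_sub_le` ([3, (5.2)]) with the SAME double sum on the right:
for a reduced class `a, b < d`, `d ≤ X`, `2 ≤ X`, `0 < η ≤ 1`,
`|S_{d,γ}(R; X) − η²X²/(d²N(R))| ≤ 9X/N(R) + Q^{-1} ∑_{0<|s|≤Q} ∑_{|t|≤Q} [R ∣ t − s·2^{1/3}]·w(s)w'(t)`.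
The class only shifts the line (phase of modulus one) and shrinks the box.
[cite: HeathBrownMoroz2004, Lemma 2.2] [cite: HeathBrownActa2001, §5 (5.2)] -/
theorem abs_classLatticeCount_sub_le {R : Ideal (𝓞 K)} (hR : Squarefree (Ideal.absNorm R))
    {d a b : ℕ} (hd : 0 < d) (ha : a < d) (hb : b < d) (hRd : Nat.Coprime d (Ideal.absNorm R))
    {X η Q : ℝ} (hX : (d : ℝ) ≤ X) (hX2 : 2 ≤ X) (hη0 : 0 < η) (hη1 : η ≤ 1) (hQN : Q < Ideal.absNorm R)
    (hNQ : (Ideal.absNorm R : ℝ) ≤ 2 * Q) :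
    |(classLatticeCount X η d a b R : ℝ) - η ^ 2 * X ^ 2 / ((d : ℝ) ^ 2 * Ideal.absNorm R)| ≤
      9 * X / Ideal.absNorm R +
        Q⁻¹ * ∑ s ∈ (Icc (-⌊Q⌋) ⌊Q⌋).filter (· ≠ 0), ∑ t ∈ Icc (-⌊Q⌋) ⌊Q⌋,
          (if R ∣ Ideal.span {(t : 𝓞 K) - (s : 𝓞 K) * θint} then (1 : ℝ) else 0) *
            (min (2 * X) (2 * Q / |(s : ℝ)|) *
              (if t = 0 then 2 * X else min (2 * X) (2 * Q / |(t : ℝ)|))) := by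
  -- data
  have hR0 : R ≠ ⊥ := fun h => by rw [h, Ideal.absNorm_bot] at hR; exact not_squarefree_zero hR
  set N : ℕ := Ideal.absNorm R with hNdef
  have hN1 : 1 ≤ N := Nat.one_le_iff_ne_zero.mpr fun h => hR0 (Ideal.absNorm_eq_zero_iff.mp h)
  have hN : 0 < N := hN1
  have hNr : (1 : ℝ) ≤ N := by exact_mod_cast hN1
  have hNpos : (0 : ℝ) < N := by linarith
  have hQ0 : 0 < Q := by linarith
  have hX0 : 0 < X := by linarith
  have hd0 : (0 : ℝ) < d := by exact_mod_cast hd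
  obtain ⟨n, hn⟩ := exists_int_θint_sub_mem_of_squarefree hR
  obtain ⟨u, v, huv⟩ := Nat.isCoprime_iff_coprime.mpr hRd
  have hu : ((N : ℕ) : ℤ) ∣ (d : ℤ) * u - 1 := ⟨-v, by rw [hNdef]; linarith⟩
  -- the rectangle
  obtain ⟨hmono₁, hL₁η, hL₁X⟩ := quotient_side_bounds hd ha hX hX2 hη0.le hη1
  obtain ⟨hmono₂, hL₂η, hL₂X⟩ := quotient_side_bounds hd hb hX hX2 hη0.le hη1
  set A₁ : ℕ := (⌊X⌋₊ - a) / d with hA₁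
  set A₂ : ℕ := (⌊X⌋₊ - b) / d with hA₂
  set L₁ : ℕ := (⌊X * (1 + η)⌋₊ - a) / d - A₁ with hL₁
  set L₂ : ℕ := (⌊X * (1 + η)⌋₊ - b) / d - A₂ with hL₂
  have hM₁ : (⌊X * (1 + η)⌋₊ - a) / d = A₁ + L₁ := by omega
  have hM₂ : (⌊X * (1 + η)⌋₊ - b) / d = A₂ + L₂ := by omega
  have hcount : classLatticeCount X η d a b R =
      #{xy ∈ Ioc A₁ (A₁ + L₁) ×ˢ Ioc A₂ (A₂ + L₂) |
        ((N : ℕ) : ℤ) ∣ (xy.1 : ℤ) + (xy.2 : ℤ) * n + u * (a + n * b)} := by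
    rw [classLatticeCount_eq_card_rect hR hn hu hd ha hb hX, ← hA₁, ← hA₂, hM₁, hM₂]
  -- main term `|L₁L₂ − η²X²/d²| ≤ 6X`
  have hL0₁ : (0 : ℝ) ≤ L₁ := Nat.cast_nonneg _
  have hL0₂ : (0 : ℝ) ≤ L₂ := Nat.cast_nonneg _
  have hηXd : 0 ≤ η * X / d := by positivity
  have hηXd' : η * X / d ≤ X := by
    rw [div_le_iff₀ hd0]
    have h1 : (1 : ℝ) ≤ d := by exact_mod_cast hd
    calc η * X ≤ 1 * X := mul_le_mul_of_nonneg_right hη1 hX0.le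
      _ ≤ X * d := by rw [one_mul]; exact le_mul_of_one_le_right hX0.le h1
  have hmain : |(L₁ : ℝ) * L₂ - η ^ 2 * X ^ 2 / (d : ℝ) ^ 2| ≤ 6 * X := by
    have e : (L₁ : ℝ) * L₂ - η ^ 2 * X ^ 2 / (d : ℝ) ^ 2 =
        (L₁ : ℝ) * ((L₂ : ℝ) - η * X / d) + (η * X / d) * ((L₁ : ℝ) - η * X / d) := by
      field_simp; ring
    rw [e]
    calc |(L₁ : ℝ) * ((L₂ : ℝ) - η * X / d) + (η * X / d) * ((L₁ : ℝ) - η * X / d)|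
        ≤ |(L₁ : ℝ) * ((L₂ : ℝ) - η * X / d)| + |(η * X / d) * ((L₁ : ℝ) - η * X / d)| := abs_add_le _ _
      _ = (L₁ : ℝ) * |(L₂ : ℝ) - η * X / d| + (η * X / d) * |(L₁ : ℝ) - η * X / d| := by
          rw [abs_mul, abs_mul, abs_of_nonneg hL0₁, abs_of_nonneg hηXd]
      _ ≤ 2 * X * 2 + X * 2 := add_le_add (mul_le_mul hL₁X hL₂η (abs_nonneg _) (by linarith))
          (mul_le_mul hηXd' hL₁η (abs_nonneg _) (by linarith))
      _ = 6 * X := by ring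
  -- the Fourier bound
  have herr := abs_card_filter_dvd_shift_sub_le hN n (u * (a + n * b)) (Ioc A₁ (A₁ + L₁)) (Ioc A₂ (A₂ + L₂))
  rw [← hcount, Nat.card_Ioc, Nat.card_Ioc, Nat.add_sub_cancel_left, Nat.add_sub_cancel_left] at herr
  -- the weights (verbatim from `abs_latticeCount_sub_le`)
  set W : ℤ → ℝ := fun s => min (2 * X) (2 * Q / |(s : ℝ)|) with hW
  set W' : ℤ → ℝ := fun t => if t = 0 then 2 * X else min (2 * X) (2 * Q / |(t : ℝ)|) with hW'
  set Φ : ℤ × ℤ → ℝ := fun st =>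
    (if R ∣ Ideal.span {(st.2 : 𝓞 K) - (st.1 : 𝓞 K) * θint} then (1 : ℝ) else 0) * (W st.1 * W' st.2)
    with hΦ
  have hW0 : ∀ s, 0 ≤ W s := fun s => by simp only [hW]; exact le_min (by linarith) (by positivity)
  have hW'0 : ∀ t, 0 ≤ W' t := fun t => by
    simp only [hW']; split_ifs; · linarith
    · exact le_min (by linarith) (by positivity)
  have hΦ0 : ∀ st, 0 ≤ Φ st := fun st => by
    simp only [hΦ]
    exact mul_nonneg (by split_ifs <;> norm_num) (mul_nonneg (hW0 _) (hW'0 _))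
  set c : ℤ → ℤ := fun z => if 2 * z ≤ (N : ℤ) then z else z - N with hc
  set ψ : ℕ → ℤ × ℤ := fun h => (c h, c ((h * n) % (N : ℤ))) with hψ
  have hb0 : ∀ h : ℕ, 0 ≤ ((h : ℤ) * n) % (N : ℤ) := fun h => Int.emod_nonneg _ (by exact_mod_cast hN.ne')
  have hbN : ∀ h : ℕ, ((h : ℤ) * n) % (N : ℤ) < N := fun h => Int.emod_lt_of_pos _ (by exact_mod_cast hN)
  -- (A) pointwise comparison
  have hptw : ∀ h ∈ Ico 1 N, ‖∑ x ∈ Ioc A₁ (A₁ + L₁), e ((h : ℝ) * x / N)‖ *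
      ‖∑ y ∈ Ioc A₂ (A₂ + L₂), e ((h : ℝ) * (n * y) / N)‖ ≤ Φ (ψ h) := by
    intro h hh
    rw [mem_Ico] at hh
    obtain ⟨hh1, hhN⟩ := hh
    set bb : ℤ := ((h : ℤ) * n) % (N : ℤ) with hbdef
    have hind : R ∣ Ideal.span {((c bb : ℤ) : 𝓞 K) - ((c h : ℤ) : 𝓞 K) * θint} := by
      rw [dvd_span_sub_mul_θint_iff hR hn]
      obtain ⟨δ₁, h₁⟩ := exists_centered_eq_add_mul N bb
      obtain ⟨δ₂, h₂⟩ := exists_centered_eq_add_mul N (h : ℤ)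
      have hb : bb = (h : ℤ) * n - ((h : ℤ) * n / N) * N := by
        have := Int.emod_add_mul_ediv ((h : ℤ) * n) N; rw [← hbdef] at this; linarith
      simp only [hc]
      rw [h₁, h₂, hb, ← hNdef]
      exact ⟨-((h : ℤ) * n / N) + δ₁ - δ₂ * n, by ring⟩
    have hF : ‖∑ x ∈ Ioc A₁ (A₁ + L₁), e ((h : ℝ) * x / N)‖ ≤ W (c h) := by
      simp only [hW]
      refine le_min ((norm_sum_Ioc_e_le_length A₁ L₁ _).trans hL₁X) ?_
      refine (norm_sum_Ioc_e_le_div_min A₁ L₁ hh1 hhN).trans ?_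
      have hca : |((c h : ℤ) : ℝ)| = ((min h (N - h) : ℕ) : ℝ) := by
        have h' := abs_centered_eq_min N (z := (h : ℤ)) (by omega) (by exact_mod_cast hhN)
        simp only [hc]
        rw [show ((N : ℤ) - (h : ℤ)) = ((N - h : ℕ) : ℤ) by omega] at h'
        have h'' : ((|(if 2 * (h : ℤ) ≤ (N : ℤ) then (h : ℤ) else (h : ℤ) - N)| : ℤ) : ℝ) =
            ((min (h : ℤ) ((N - h : ℕ) : ℤ) : ℤ) : ℝ) := by rw [h']
        rw [Int.cast_abs] at h''
        rw [h'']
        norm_cast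
      have hmin0 : (0 : ℝ) < ((min h (N - h) : ℕ) : ℝ) := by
        have : 0 < min h (N - h) := lt_min hh1 (Nat.sub_pos_of_lt hhN)
        exact_mod_cast this
      rw [hca, div_le_div_iff₀ hmin0 hmin0]
      exact mul_le_mul_of_nonneg_right hNQ hmin0.le
    have hG : ‖∑ y ∈ Ioc A₂ (A₂ + L₂), e ((h : ℝ) * (n * y) / N)‖ ≤ W' (c bb) := by
      rw [sum_e_mul_eq_sum_e_emod hN n h, ← hbdef]
      simp only [hW']
      by_cases hbz : bb = 0
      · have hcb : c bb = 0 := by simp only [hc]; rw [hbz]; simp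
        rw [if_pos hcb, hbz]
        refine le_trans ?_ hL₂X
        refine (norm_sum_le _ _).trans (le_of_eq ?_)
        simp
      · have hb1 : 0 < bb := lt_of_le_of_ne (hb0 h) (Ne.symm hbz)
        have hcb : c bb ≠ 0 := centered_ne_zero N hb1 (hbN h)
        rw [if_neg hcb]
        obtain ⟨b', hb'⟩ : ∃ b' : ℕ, (b' : ℤ) = bb := ⟨bb.toNat, Int.toNat_of_nonneg hb1.le⟩
        have hb'1 : 0 < b' := by omega
        have hb'N : b' < N := by have := hbN h; omega
        have hterm : ∀ y ∈ Ioc A₂ (A₂ + L₂), e ((bb : ℝ) * y / N) = e ((b' : ℝ) * y / N) := by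
          intro y _; rw [← hb', Int.cast_natCast]
        rw [sum_congr rfl hterm]
        refine le_min ((norm_sum_Ioc_e_le_length A₂ L₂ _).trans hL₂X) ?_
        refine (norm_sum_Ioc_e_le_div_min A₂ L₂ hb'1 hb'N).trans ?_
        have hcb' : |((c bb : ℤ) : ℝ)| = ((min b' (N - b') : ℕ) : ℝ) := by
          have h' := abs_centered_eq_min N (z := bb) hb1.le (hbN h)
          simp only [hc]
          rw [← hb', show ((N : ℤ) - (b' : ℤ)) = ((N - b' : ℕ) : ℤ) by omega] at h'
          rw [← hb']
          have h'' : ((|(if 2 * (b' : ℤ) ≤ (N : ℤ) then (b' : ℤ) else (b' : ℤ) - N)| : ℤ) : ℝ) =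
              ((min (b' : ℤ) ((N - b' : ℕ) : ℤ) : ℤ) : ℝ) := by rw [h']
          rw [Int.cast_abs] at h''
          rw [h'']
          norm_cast
        have hmin0 : (0 : ℝ) < ((min b' (N - b') : ℕ) : ℝ) := by
          have : 0 < min b' (N - b') := lt_min hb'1 (Nat.sub_pos_of_lt hb'N)
          exact_mod_cast this
        rw [hcb', div_le_div_iff₀ hmin0 hmin0]
        exact mul_le_mul_of_nonneg_right hNQ hmin0.le
    calc ‖∑ x ∈ Ioc A₁ (A₁ + L₁), e ((h : ℝ) * x / N)‖ * ‖∑ y ∈ Ioc A₂ (A₂ + L₂), e ((h : ℝ) * (n * y) / N)‖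
        ≤ W (c h) * W' (c bb) := mul_le_mul hF hG (norm_nonneg _) (hW0 _)
      _ = Φ (ψ h) := by simp only [hΦ, hψ, ← hbdef]; rw [if_pos hind, one_mul]
  -- (B) injectivity of the centring on `[1, N)`
  have hinj : Set.InjOn ψ ↑(Ico 1 N) := by
    intro a₁ h₁ a₂ h₂ h12
    rw [mem_coe, mem_Ico] at h₁ h₂
    simp only [hψ, Prod.mk.injEq] at h12
    have := centered_injOn N (z₁ := (a₁ : ℤ)) (z₂ := (a₂ : ℤ)) (by omega) (by exact_mod_cast h₁.2)
      (by omega) (by exact_mod_cast h₂.2) h12.1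
    exact_mod_cast this
  -- (C) the image lies in the box `T`
  set T := ((Icc (-⌊Q⌋) ⌊Q⌋).filter (· ≠ (0 : ℤ))) ×ˢ (Icc (-⌊Q⌋) ⌊Q⌋) with hT
  have hbox : ∀ z : ℤ, 0 ≤ z → z < N → c z ∈ Icc (-⌊Q⌋) ⌊Q⌋ := by
    intro z hz0 hzN
    have h2 : 2 * |c z| ≤ (N : ℤ) := two_mul_abs_centered_le N hz0 hzN
    have h2r : (2 : ℝ) * ((|c z| : ℤ) : ℝ) ≤ N := by exact_mod_cast h2
    have habs : ((|c z| : ℤ) : ℝ) ≤ Q := by linarith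
    have hfl : |c z| ≤ ⌊Q⌋ := Int.le_floor.mpr habs
    rw [mem_Icc]
    exact ⟨(abs_le.mp hfl).1, (abs_le.mp hfl).2⟩
  have hmaps : ∀ h ∈ Ico 1 N, ψ h ∈ T := by
    intro h hh
    rw [mem_Ico] at hh
    simp only [hT, hψ, mem_product, mem_filter]
    refine ⟨⟨hbox h (by omega) (by exact_mod_cast hh.2), ?_⟩, hbox _ (hb0 h) (hbN h)⟩
    exact centered_ne_zero N (by exact_mod_cast hh.1) (by exact_mod_cast hh.2)
  -- (D) summation
  have hsum : ∑ h ∈ Ico 1 N, ‖∑ x ∈ Ioc A₁ (A₁ + L₁), e ((h : ℝ) * x / N)‖ *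
      ‖∑ y ∈ Ioc A₂ (A₂ + L₂), e ((h : ℝ) * (n * y) / N)‖ ≤ ∑ st ∈ T, Φ st := by
    calc ∑ h ∈ Ico 1 N, ‖∑ x ∈ Ioc A₁ (A₁ + L₁), e ((h : ℝ) * x / N)‖ *
          ‖∑ y ∈ Ioc A₂ (A₂ + L₂), e ((h : ℝ) * (n * y) / N)‖
        ≤ ∑ h ∈ Ico 1 N, Φ (ψ h) := sum_le_sum hptw
      _ = ∑ st ∈ (Ico 1 N).image ψ, Φ st := (sum_image hinj).symm
      _ ≤ ∑ st ∈ T, Φ st := sum_le_sum_of_subset_of_nonneg (fun st hst => by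
          rw [mem_image] at hst
          obtain ⟨h, hh, rfl⟩ := hst
          exact hmaps h hh) fun st _ _ => hΦ0 st
  have hTsum : ∑ st ∈ T, Φ st = ∑ s ∈ (Icc (-⌊Q⌋) ⌊Q⌋).filter (· ≠ 0), ∑ t ∈ Icc (-⌊Q⌋) ⌊Q⌋, Φ (s, t) :=
    sum_product _ _ _
  -- assemble
  have hNQ' : (N : ℝ)⁻¹ ≤ Q⁻¹ := inv_anti₀ hQ0 hQN.le
  have hd2 : (0 : ℝ) < (d : ℝ) ^ 2 := by positivity
  calc |(classLatticeCount X η d a b R : ℝ) - η ^ 2 * X ^ 2 / ((d : ℝ) ^ 2 * N)|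
      ≤ |(classLatticeCount X η d a b R : ℝ) - (L₁ : ℝ) * L₂ / N| +
          |(L₁ : ℝ) * L₂ / N - η ^ 2 * X ^ 2 / ((d : ℝ) ^ 2 * N)| := abs_sub_le _ _ _
    _ ≤ (N : ℝ)⁻¹ * ∑ st ∈ T, Φ st + 6 * X / N := by
        refine add_le_add (herr.trans (mul_le_mul_of_nonneg_left hsum (by positivity))) ?_
        have e : (L₁ : ℝ) * L₂ / N - η ^ 2 * X ^ 2 / ((d : ℝ) ^ 2 * N) =
            ((L₁ : ℝ) * L₂ - η ^ 2 * X ^ 2 / (d : ℝ) ^ 2) / N := by field_simp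
        rw [e, abs_div, abs_of_pos hNpos]
        exact div_le_div_of_nonneg_right hmain hNpos.le
    _ ≤ Q⁻¹ * ∑ st ∈ T, Φ st + 9 * X / N := by
        gcongr
        · linarith
    _ = _ := by rw [add_comm, hTsum]

end Literature.NumberTheory.Sieve.CubicSieve

end
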